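import Summits.NavierStokesRegularity.FluidComputer.SmoothedHillVortexProfile
import Mathlib.Analysis.Calculus.Deriv.MeanValue
import HarnessLib

/-!
# The smoothed Hill spherical vortex, II: the potential profile `g` and the speed envelope

Cell `ns-blowup`, seat `ns-blowup-fc-prover-3` (g6); sequel of `SmoothedHillVortexProfile.lean` (M. J. M. Hill
1894; Acheson §5.5). LABEL: kinematics; WHAT THIS IS NOT: not NS evidence (an explicit profile). The potential
profile `g` — the scalar in the vector potential `g(|x|²) e_z × x` of the smoothed Hill vortex — is
defined as the primitive of `g' = slope` normalised by the dipole tail, and its two-sided bounds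
are proved:

* `potential`, `hasDerivAt_potential` (`g' = slope`), `contDiff_potential`, `potential_antitone`;
* `potential_of_ge` — the DIPOLE TAIL `g(s) = (K/3)(s√s)⁻¹` for `s ≥ b²`;
  `potential_of_le` — the HILL CORE `g(s) = g(0) − (M/10) s` for `s ≤ a²`;
* `potential_nonneg`, `potential_zero_le` (`g(0) ≤ M b²/6`), `le_potential_zero`
  (`M a²/6 ≤ g(0)`: the layer is estimated by `−g' ≥ (M a⁵/10) s^{-5/2}`, and the two `a⁵/b³`
  terms cancel exactly), `potential_le_of_le` (`g(s) ≤ M b²/6 − (M/10)s` on `s ≤ b²`);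
* `four_sq_add_le` — the SPEED ENVELOPE `4 g(s)² + 4 g'(s)² s² ≤ (M b²/3)²` for all `s ≥ 0`: the
  field `u = (−2g' x₀x₂, −2g' x₁x₂, 2g + 2g'(x₀²+x₁²))` then satisfies `‖u(x)‖ ≤ M b²/3` everywhere
  (sequel), the centre speed of the exact Hill vortex of radius `b` (`u(0) = 2 g(0) e_z`,
  Acheson (5.25): centre speed `(5/2)·U_translation`).

References: M. J. M. Hill, Phil. Trans. R. Soc. London A 185 (1894) 213–245 [cite: Hill1894, Art. 1–4];
D. J. Acheson, *Elementary Fluid Dynamics* (OUP 1990) §5.5 [cite: Acheson1990, §5.5, eqs. (5.15)–(5.25)].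
-/

noncomputable section

open Real Set MeasureTheory intervalIntegral

namespace Summit.NavierStokesRegularity.FluidComputer

namespace SmoothedHill

variable {M a b : ℝ}

/-! ## The potential `g` -/

/-- The antiderivative used for the dipole tail: `d/dσ (σ √σ)⁻¹ = −(3/2) / (σ² √σ)` for `σ > 0`.
[folklore] -/
theorem hasDerivAt_inv_mul_sqrt {σ : ℝ} (hσ : 0 < σ) :
    HasDerivAt (fun σ : ℝ => (σ * Real.sqrt σ)⁻¹) (-(3 / 2) / (σ ^ 2 * Real.sqrt σ)) σ := by
  have hsq : 0 < Real.sqrt σ := Real.sqrt_pos.2 hσ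
  have hss : Real.sqrt σ * Real.sqrt σ = σ := Real.mul_self_sqrt hσ.le
  have h1 : HasDerivAt (fun σ : ℝ => σ * Real.sqrt σ)
      (1 * Real.sqrt σ + σ * (1 / (2 * Real.sqrt σ))) σ :=
    (hasDerivAt_id σ).mul (Real.hasDerivAt_sqrt hσ.ne')
  have h2 : HasDerivAt (fun σ : ℝ => (σ * Real.sqrt σ)⁻¹)
      (-(1 * Real.sqrt σ + σ * (1 / (2 * Real.sqrt σ))) / (σ * Real.sqrt σ) ^ 2) σ :=
    h1.inv (by positivity)
  refine h2.congr_deriv ?_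
  have hσ2 : 0 < σ ^ 2 * Real.sqrt σ := by positivity
  field_simp
  nlinarith [hss]

/-- The potential profile `g(s) = K/(3 b³) + ∫_{b²}^{s} g'(σ) dσ` (the unique primitive of `g'`
with the point-dipole tail `g(s) = (K/3) (s√s)⁻¹` for `s ≥ b²`); the velocity field is
`curl (g(|x|²) (e_z × x))`. [folklore] -/
def potential (M a b s : ℝ) : ℝ :=
  tailConst M a b / 3 * (b ^ 2 * b)⁻¹ + ∫ σ in b ^ 2..s, slope M a b σ

/-- `g' = slope`. [folklore] -/
theorem hasDerivAt_potential (M a b s : ℝ) : HasDerivAt (potential M a b) (slope M a b s) s := by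
  unfold potential
  exact (((continuous_slope M a b).integral_hasStrictDerivAt (b ^ 2) s).hasDerivAt).const_add _

/-- `deriv g = g'`. [folklore] -/
theorem deriv_potential (M a b : ℝ) : deriv (potential M a b) = slope M a b :=
  funext fun s => (hasDerivAt_potential M a b s).deriv

/-- `g` is differentiable. [folklore] -/
theorem differentiable_potential (M a b : ℝ) : Differentiable ℝ (potential M a b) := fun s =>
  (hasDerivAt_potential M a b s).differentiableAt

/-- `g` is smooth. [folklore] -/
theorem contDiff_potential (M a b : ℝ) {n : ℕ∞} : ContDiff ℝ n (potential M a b) := by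
  have h : ContDiff ℝ (⊤ : ℕ∞) (potential M a b) := by
    rw [contDiff_infty_iff_deriv, deriv_potential]
    exact ⟨differentiable_potential M a b, contDiff_slope M a b⟩
  exact h.of_le (by exact_mod_cast le_top)

/-- `g` is continuous. [folklore] -/
theorem continuous_potential (M a b : ℝ) : Continuous (potential M a b) :=
  (differentiable_potential M a b).continuous

/-- `g` is antitone (for `0 ≤ M`). [folklore] -/
theorem potential_antitone (hM : 0 ≤ M) : Antitone (potential M a b) :=
  antitone_of_deriv_nonpos (differentiable_potential M a b) fun s => by
    rw [deriv_potential]; exact (slope_mem hM a b s).2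

/-- Differences of `g` are integrals of `g'`. [folklore] -/
theorem potential_sub (M a b s t : ℝ) :
    potential M a b s - potential M a b t = ∫ σ in t..s, slope M a b σ := by
  unfold potential
  rw [← integral_add_adjacent_intervals
    ((continuous_slope M a b).intervalIntegrable (b ^ 2) t)
    ((continuous_slope M a b).intervalIntegrable t s)]
  ring

/-- Value at the outer radius: `g(b²) = K/(3b³)`. [folklore] -/
theorem potential_sq_outer (M a b : ℝ) :
    potential M a b (b ^ 2) = tailConst M a b / 3 * (b ^ 2 * b)⁻¹ := by
  simp [potential]

/-- **The dipole tail of the potential**: for `b² ≤ s` (`0 ≤ a < b`),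
`g(s) = (K/3) (s √s)⁻¹`. [folklore] -/
theorem potential_of_ge (ha : 0 ≤ a) (hab : a < b) {s : ℝ} (hs : b ^ 2 ≤ s) :
    potential M a b s = tailConst M a b / 3 * (s * Real.sqrt s)⁻¹ := by
  have hb : 0 < b := lt_of_le_of_lt ha hab
  have hb2 : 0 < b ^ 2 := by positivity
  have key : ∫ σ in b ^ 2..s, slope M a b σ =
      tailConst M a b / 3 * (s * Real.sqrt s)⁻¹ - tailConst M a b / 3 * (b ^ 2 * Real.sqrt (b ^ 2))⁻¹ := by
    have hderiv : ∀ σ ∈ uIcc (b ^ 2) s,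
        HasDerivAt (fun σ : ℝ => tailConst M a b / 3 * (σ * Real.sqrt σ)⁻¹) (slope M a b σ) σ := by
      intro σ hσ
      rw [uIcc_of_le hs] at hσ
      have hσ0 : 0 < σ := lt_of_lt_of_le hb2 hσ.1
      have h := (hasDerivAt_inv_mul_sqrt hσ0).const_mul (tailConst M a b / 3)
      rw [slope_of_ge ha hab hσ.1]
      exact h.congr_deriv (by ring)
    exact integral_eq_sub_of_hasDerivAt hderiv ((continuous_slope M a b).intervalIntegrable _ _)
  unfold potential
  rw [key, Real.sqrt_sq hb.le]
  ring

/-- **The core of the potential**: for `s ≤ a²` (`0 ≤ a < b`), `g(s) = g(0) − (M/10) s`. [folklore] -/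
theorem potential_of_le (ha : 0 ≤ a) (hab : a < b) {s : ℝ} (hs : s ≤ a ^ 2) :
    potential M a b s = potential M a b 0 - M / 10 * s := by
  have h := potential_sub M a b s 0
  have hc : ∫ σ in (0 : ℝ)..s, slope M a b σ = ∫ _ in (0 : ℝ)..s, -(M / 10) := by
    refine integral_congr fun σ hσ => slope_of_le ha hab ?_
    rcases le_or_gt 0 s with h0 | h0
    · rw [uIcc_of_le h0] at hσ; exact hσ.2.trans hs
    · rw [uIcc_of_ge h0.le] at hσ; nlinarith [hσ.2, sq_nonneg a]
  rw [hc, intervalIntegral.integral_const, smul_eq_mul] at h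
  linarith

/-- `0 ≤ g` on `[0, ∞)` (indeed everywhere: `g` is antitone with positive tail). [folklore] -/
theorem potential_nonneg (hM : 0 ≤ M) (ha : 0 ≤ a) (hab : a < b) (s : ℝ) :
    0 ≤ potential M a b s := by
  have hb : 0 < b := lt_of_le_of_lt ha hab
  rcases le_or_gt (b ^ 2) s with h | h
  · rw [potential_of_ge ha hab h]
    have hs0 : 0 < s := lt_of_lt_of_le (by positivity) h
    have := tailConst_nonneg hM ha hab
    positivity
  · have h1 := potential_antitone (a := a) (b := b) hM h.le
    rw [potential_sq_outer] at h1
    have := tailConst_nonneg hM ha hab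
    exact le_trans (by positivity) h1

/-- Upper bound at the origin: `g(0) ≤ M b²/6`. [folklore] -/
theorem potential_zero_le (hM : 0 ≤ M) (ha : 0 ≤ a) (hab : a < b) :
    potential M a b 0 ≤ M * b ^ 2 / 6 := by
  have hb : 0 < b := lt_of_le_of_lt ha hab
  have h := potential_sub M a b 0 (b ^ 2)
  rw [potential_sq_outer, integral_symm] at h
  have hK := tailConst_le hM ha hab
  have hint : ∫ σ in (0 : ℝ)..b ^ 2, slope M a b σ ≥ ∫ _ in (0 : ℝ)..b ^ 2, -(M / 10) := by
    refine integral_mono_on (by positivity) intervalIntegrable_const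
      ((continuous_slope M a b).intervalIntegrable _ _) fun σ _ => (slope_mem hM a b σ).1
  rw [intervalIntegral.integral_const, smul_eq_mul] at hint
  have hK' : tailConst M a b / 3 * (b ^ 2 * b)⁻¹ ≤ M * b ^ 2 / 15 := by
    rw [show M * b ^ 2 / 15 = M * b ^ 5 / 5 / 3 * (b ^ 2 * b)⁻¹ by field_simp; ring]
    gcongr
  linarith

/-- Upper envelope on `[0, b²]`… in fact for all `s ≤ b²`: `g(s) ≤ M b²/6 − (M/10) s`. [folklore] -/
theorem potential_le_of_le (hM : 0 ≤ M) (ha : 0 ≤ a) (hab : a < b) {s : ℝ} (hs : s ≤ b ^ 2) :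
    potential M a b s ≤ M * b ^ 2 / 6 - M / 10 * s := by
  have hb : 0 < b := lt_of_le_of_lt ha hab
  have h := potential_sub M a b s (b ^ 2)
  rw [potential_sq_outer, integral_symm] at h
  have hK := tailConst_le hM ha hab
  have hint : ∫ σ in s..b ^ 2, slope M a b σ ≥ ∫ _ in s..b ^ 2, -(M / 10) := by
    refine integral_mono_on hs intervalIntegrable_const
      ((continuous_slope M a b).intervalIntegrable _ _) fun σ _ => (slope_mem hM a b σ).1
  rw [intervalIntegral.integral_const, smul_eq_mul] at hint
  have hK' : tailConst M a b / 3 * (b ^ 2 * b)⁻¹ ≤ M * b ^ 2 / 15 := by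
    rw [show M * b ^ 2 / 15 = M * b ^ 5 / 5 / 3 * (b ^ 2 * b)⁻¹ by field_simp; ring]
    gcongr
  linarith

/-- **Lower bound at the origin**: `M a²/6 ≤ g(0)` (`0 < a < b`, `0 ≤ M`). The layer
`[a², b²]` is estimated through `−g'(σ) ≥ (M a⁵/10)/(σ²√σ)` and the tail constant through
`K ≥ M a⁵/5`; the two `a⁵/b³` terms cancel exactly. [folklore] -/
theorem le_potential_zero (hM : 0 ≤ M) (ha : 0 < a) (hab : a < b) :
    M * a ^ 2 / 6 ≤ potential M a b 0 := by
  have hb : 0 < b := ha.trans hab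
  have ha2 : 0 < a ^ 2 := by positivity
  have hab2 : a ^ 2 ≤ b ^ 2 := by nlinarith
  -- g(0) = K/(3b³) - ∫_0^{a²} slope - ∫_{a²}^{b²} slope
  have h := potential_sub M a b 0 (b ^ 2)
  rw [potential_sq_outer, integral_symm,
    ← integral_add_adjacent_intervals ((continuous_slope M a b).intervalIntegrable 0 (a ^ 2))
      ((continuous_slope M a b).intervalIntegrable (a ^ 2) (b ^ 2))] at h
  -- core piece
  have hcore : ∫ σ in (0 : ℝ)..a ^ 2, slope M a b σ = -(M / 10) * a ^ 2 := by
    rw [integral_congr (fun σ hσ => slope_of_le ha.le hab (by rw [uIcc_of_le ha2.le] at hσ; exact hσ.2)),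
      intervalIntegral.integral_const, smul_eq_mul]
    ring
  -- layer piece
  have hlayer : ∫ σ in a ^ 2..b ^ 2, slope M a b σ ≤
      -(M / 15 * (a ^ 2 - a ^ 5 * (b ^ 2 * b)⁻¹)) := by
    have hF : ∀ σ ∈ uIcc (a ^ 2) (b ^ 2),
        HasDerivAt (fun σ : ℝ => -(M * a ^ 5 / 10) * (2 / 3) * (σ * Real.sqrt σ)⁻¹)
          (M * a ^ 5 / 10 / (σ ^ 2 * Real.sqrt σ)) σ := by
      intro σ hσ
      rw [uIcc_of_le hab2] at hσ
      have hσ0 : 0 < σ := lt_of_lt_of_le ha2 hσ.1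
      have h := (hasDerivAt_inv_mul_sqrt hσ0).const_mul (-(M * a ^ 5 / 10) * (2 / 3))
      refine h.congr_deriv ?_
      have : 0 < σ ^ 2 * Real.sqrt σ := by positivity
      field_simp
    have hcont : ContinuousOn (fun σ : ℝ => M * a ^ 5 / 10 / (σ ^ 2 * Real.sqrt σ))
        (uIcc (a ^ 2) (b ^ 2)) := by
      rw [uIcc_of_le hab2]
      refine continuousOn_const.div (by fun_prop) fun σ hσ => ?_
      have hσ0 : 0 < σ := lt_of_lt_of_le ha2 hσ.1
      positivity
    have hFTC := integral_eq_sub_of_hasDerivAt hF hcont.intervalIntegrable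
    have hmono : ∫ σ in a ^ 2..b ^ 2, slope M a b σ ≤
        ∫ σ in a ^ 2..b ^ 2, -(M * a ^ 5 / 10 / (σ ^ 2 * Real.sqrt σ)) := by
      refine integral_mono_on hab2 ((continuous_slope M a b).intervalIntegrable _ _)
        hcont.intervalIntegrable.neg fun σ hσ => ?_
      have := neg_slope_ge hM ha hab hσ.1
      linarith
    rw [intervalIntegral.integral_neg, hFTC, Real.sqrt_sq hb.le, Real.sqrt_sq ha.le] at hmono
    have e2 : -(-(M * a ^ 5 / 10) * (2 / 3) * (b ^ 2 * b)⁻¹ - -(M * a ^ 5 / 10) * (2 / 3) * (a ^ 2 * a)⁻¹)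
        = -(M / 15 * (a ^ 2 - a ^ 5 * (b ^ 2 * b)⁻¹)) := by
      field_simp
      ring
    linarith
  -- tail constant piece
  have hK : M / 15 * (a ^ 5 * (b ^ 2 * b)⁻¹) ≤ tailConst M a b / 3 * (b ^ 2 * b)⁻¹ := by
    have := tailConst_ge hM ha.le hab
    rw [show M / 15 * (a ^ 5 * (b ^ 2 * b)⁻¹) = M * a ^ 5 / 5 / 3 * (b ^ 2 * b)⁻¹ by ring]
    gcongr
  have e3 : M / 15 * (a ^ 2 - a ^ 5 * (b ^ 2 * b)⁻¹) = M / 15 * a ^ 2 - M / 15 * (a ^ 5 * (b ^ 2 * b)⁻¹) := by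
    ring
  linarith

/-- **The speed envelope of the profile**: for every `s ≥ 0`,
`4 g(s)² + 4 g'(s)² s² ≤ (M b²/3)²` (`0 < a < b`, `0 ≤ M`). In the field this is
`|u(x)|² ≤ 4g² + 4g'²|x|⁴ ≤ (M b²/3)²`, i.e. the exact Hill centre speed of the outer ball bounds
the speed everywhere. [folklore] -/
theorem four_sq_add_le (hM : 0 ≤ M) (ha : 0 < a) (hab : a < b) {s : ℝ} (hs : 0 ≤ s) :
    4 * potential M a b s ^ 2 + 4 * (slope M a b s) ^ 2 * s ^ 2 ≤ (M * b ^ 2 / 3) ^ 2 := by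
  have hb : 0 < b := ha.trans hab
  have hpot0 := potential_nonneg hM ha.le hab s
  rcases le_or_gt s (b ^ 2) with h | h
  · -- inside the outer ball: Hill comparison
    have hpot := potential_le_of_le hM ha.le hab h
    have hsl := slope_mem hM a b s
    have h1 : potential M a b s ^ 2 ≤ (M * b ^ 2 / 6 - M / 10 * s) ^ 2 := by
      have hX : 0 ≤ M * b ^ 2 / 6 - M / 10 * s := by nlinarith
      exact pow_le_pow_left₀ hpot0 hpot 2
    have hsl1 : -(M / 10) ≤ slope M a b s := (Set.mem_Icc.1 hsl).1
    have hsl2 : slope M a b s ≤ 0 := (Set.mem_Icc.1 hsl).2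
    have h2 : slope M a b s ^ 2 ≤ (M / 10) ^ 2 := by
      have : |slope M a b s| ≤ M / 10 := abs_le.2 ⟨hsl1, by linarith⟩
      calc slope M a b s ^ 2 = |slope M a b s| ^ 2 := (sq_abs _).symm
        _ ≤ (M / 10) ^ 2 := pow_le_pow_left₀ (abs_nonneg _) this 2
    have hs2 : 0 ≤ s ^ 2 := sq_nonneg s
    have h3 : slope M a b s ^ 2 * s ^ 2 ≤ (M / 10) ^ 2 * s ^ 2 :=
      mul_le_mul_of_nonneg_right h2 hs2
    have h4 : 0 ≤ M ^ 2 * s * (b ^ 2 - s) :=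
      mul_nonneg (mul_nonneg (sq_nonneg M) hs) (sub_nonneg.2 h)
    have h5 : 0 ≤ M ^ 2 * s ^ 2 := mul_nonneg (sq_nonneg M) hs2
    nlinarith
  · -- the dipole tail
    have hs0 : 0 < s := lt_trans (by positivity) h
    have hsq : b ≤ Real.sqrt s := by
      calc b = Real.sqrt (b ^ 2) := (Real.sqrt_sq hb.le).symm
        _ ≤ Real.sqrt s := Real.sqrt_le_sqrt h.le
    have hsqpos : 0 < Real.sqrt s := Real.sqrt_pos.2 hs0
    have hK0 := tailConst_nonneg hM ha.le hab
    have hK := tailConst_le hM ha.le hab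
    -- potential ≤ value at b²
    have hpot : potential M a b s ≤ M * b ^ 2 / 15 := by
      have h1 := potential_antitone (a := a) (b := b) hM h.le
      rw [potential_sq_outer] at h1
      refine h1.trans ?_
      rw [show M * b ^ 2 / 15 = M * b ^ 5 / 5 / 3 * (b ^ 2 * b)⁻¹ by field_simp; ring]
      gcongr
    -- |slope| s ≤ K/(2 b³)
    have hsl : |slope M a b s| * s ≤ M * b ^ 2 / 10 := by
      rw [slope_of_ge ha.le hab h.le, abs_div, abs_neg, abs_of_nonneg (by positivity : (0:ℝ) ≤ tailConst M a b / 2),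
        abs_of_pos (by positivity : (0:ℝ) < s ^ 2 * Real.sqrt s)]
      rw [show tailConst M a b / 2 / (s ^ 2 * Real.sqrt s) * s = tailConst M a b / 2 / (s * Real.sqrt s) by
        field_simp]
      have hden : b ^ 2 * b ≤ s * Real.sqrt s := mul_le_mul h.le hsq hb.le hs0.le
      calc tailConst M a b / 2 / (s * Real.sqrt s) ≤ tailConst M a b / 2 / (b ^ 2 * b) :=
            div_le_div_of_nonneg_left (by positivity) (by positivity) hden
        _ ≤ M * b ^ 5 / 5 / 2 / (b ^ 2 * b) := by gcongr
        _ = M * b ^ 2 / 10 := by field_simp; ring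
    have h1 : potential M a b s ^ 2 ≤ (M * b ^ 2 / 15) ^ 2 := pow_le_pow_left₀ hpot0 hpot 2
    have h2 : (slope M a b s) ^ 2 * s ^ 2 ≤ (M * b ^ 2 / 10) ^ 2 := by
      rw [← mul_pow, ← sq_abs, abs_mul, abs_of_nonneg hs]
      exact pow_le_pow_left₀ (by positivity) hsl 2
    nlinarith

end SmoothedHill

end Summit.NavierStokesRegularity.FluidComputer

end
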